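import Literature.NumberTheory.Automorphic.PairLFunctionPolesRepData
import Literature.NumberTheory.Automorphic.GLOneOfHeckeCharacterBJ
import HarnessLib

/-!
# Rigidity of the pair `{λ, λ⁻¹}` of idele class characters from Jacquet–Shalika (2.1)–(2.3)
# in rank one (proof file)

Topic `NumberTheory/Automorphic`; namespace `Literature.NumberTheory.Automorphic`. Proof file
(theorems only: no definition, no named fact, no instance, no `sorry`).

**The statement.** Let `λ, λ'` be unitary idele class characters of a number field `K` such that
for almost all finite places `w` the unordered pairs `{λ'(ϖ_w), λ'(ϖ_w)⁻¹}` and `{λ(ϖ_w), λ(ϖ_w)⁻¹}`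
coincide. Then `λ' = λ` or `λ' = λ⁻¹` (`HeckeCharacter.eq_or_eq_inv_of_eventually_pair_eq`).

This is the rank-one case of the rigidity of isobaric automorphic representations
(Jacquet–Shalika 1981 II, Thm. 4.4: `λ ⊞ λ⁻¹ ≃ λ' ⊞ λ'⁻¹` on `GL(2)` forces `{λ, λ⁻¹} = {λ', λ'⁻¹}`),
which is the step "`{μ/μ^θ, μ^θ/μ} = {μ'/μ'^θ, μ'^θ/μ'}` ⟹ (replacing `μ'` by `μ'^θ`) `μ/μ'` is
`θ`-invariant" of the dihedral case of D. Ramakrishnan, *Modularity of the Rankin–Selberg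
`L`-series, and multiplicity one for `SL(2)`*, Ann. of Math. 152 (2000), proof of Thm. 4.1.2 (§4.1,
p. 38 of the preprint): there the identity of pairs is the base change to `K` of
`Ad(π) ≅ Ad(π')` for `π = I_K^F(μ)`, `π' = I_K^F(μ')`.

**The proof** is Jacquet–Shalika's, run with the tree's named facts (2.1)–(2.3) for Borel–Jacquet
data (`JacquetShalika1981_multipliable_partialPairL_repData`, `…_partialPairL_boundary_repData`,
`…_partialPairL_pole_repData` of `PairLFunctionPolesRepData`; Arthur–Clozel 1989, Ch. 3 §2) at
`n = m = 1`, the characters being realised as cuspidal data on `GL(1)` with Satake parameter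
`{θ(ϖ_w)}` almost everywhere (`exists_automorphicRepData_detTwist_glOne`,
`AutomorphicRepData.hasSatakeParamAt_detTwist_glOne` of `GLOneOfHeckeCharacterBJ`; Borel–Jacquet
1979, 4.6). At a good place, `λ'(ϖ) ∈ {λ(ϖ), λ(ϖ)⁻¹}` gives the Euler-factor identity
`(1 - λ'λ⁻¹(ϖ) T)(1 - λ'λ(ϖ) T) = (1 - T)(1 - λ'²(ϖ) T)`, whence on `Re s > 1`
`L^S(s, λ'λ⁻¹) L^S(s, λ'λ) = ζ_K^S(s) L^S(s, λ'²)`. If neither `λ' = λ` nor `λ' = λ⁻¹` almost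
everywhere, the left side has a finite limit at `s = 1` ((2.2) twice, both points lying off `X`),
while the right side has a pole there (`ζ_K^S`: (2.3); `L^S(s, λ'²)`: a pole by (2.3) if `λ'² = 1`
a.e., a non-zero limit by (2.2) otherwise) — contradiction. Two Hecke characters agreeing at almost
all uniformizers are equal (`HeckeCharacter.ext_of_eventually_valueAtUniformizer_eq`,
Cassels–Fröhlich VII Prop. 4.1).

## References

* H. Jacquet, J. A. Shalika, *On Euler products and the classification of automorphic forms II*,
  Amer. J. Math. 103 (1981), 777–815, Prop. 3.6, Thm. 4.4. [JacquetShalikaAJM1981II]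
* J. Arthur, L. Clozel, *Simple algebras, base change, and the advanced theory of the trace
  formula*, Ann. of Math. Stud. 120 (1989), Ch. 3 §2, (2.1)–(2.3). [ArthurClozelAMS120]
* D. Ramakrishnan, *Modularity of the Rankin–Selberg `L`-series, and multiplicity one for `SL(2)`*,
  Ann. of Math. (2) 152 (2000), 45–111, §4.1, proof of Thm. 4.1.2 (dihedral case). [Ramakrishnan2000]
* A. Borel, H. Jacquet, *Automorphic forms and automorphic representations*, Proc. Sympos. Pure
  Math. 33 (1979), part 1, §4.6. [BorelJacquetCorvallis1979]
-/

noncomputable section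

open scoped MatrixGroups NumberField Classical Topology
open NumberField IsDedekindDomain MeasureTheory Filter Polynomial

namespace Literature.NumberTheory.Automorphic

open AdelicGroupData
open Literature.NumberTheory.GaloisRepresentations (HeckeCharacter ideleGroup localUnits)

section GLOneData

variable {K : Type} [Field K] [NumberField K]

/-- `χ(ϖ_v)` is the value of `χ` at the idele `(…, 1, ϖ_v, 1, …)`. [folklore] -/
private theorem vAU_apply' (χ : HeckeCharacter K) (v : HeightOneSpectrum (𝓞 K)) :
    χ.valueAtUniformizer v =
      ((χ (localUnits v (GaloisRepresentations.HeckeCharacter.uniformizer K v)) : ℂˣ) : ℂ) := by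
  simp only [GaloisRepresentations.HeckeCharacter.valueAtUniformizer,
    GaloisRepresentations.HeckeCharacter.localComponent_apply]

/-- `(χ₁ χ₂)(ϖ_v) = χ₁(ϖ_v) χ₂(ϖ_v)`. [folklore] -/
private theorem vAU_mul' (χ₁ χ₂ : HeckeCharacter K) (v : HeightOneSpectrum (𝓞 K)) :
    (χ₁ * χ₂).valueAtUniformizer v = χ₁.valueAtUniformizer v * χ₂.valueAtUniformizer v := by
  simp only [vAU_apply', GaloisRepresentations.HeckeCharacter.mul_apply, Units.val_mul]

/-- `χ⁻¹(ϖ_v) = χ(ϖ_v)⁻¹`. [folklore] -/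
private theorem vAU_inv' (χ : HeckeCharacter K) (v : HeightOneSpectrum (𝓞 K)) :
    χ⁻¹.valueAtUniformizer v = (χ.valueAtUniformizer v)⁻¹ := by
  simp only [vAU_apply', GaloisRepresentations.HeckeCharacter.inv_apply, Units.val_inv_eq_inv_val]

/-- `χ(ϖ_v) ≠ 0`. [folklore] -/
private theorem vAU_ne_zero' (χ : HeckeCharacter K) (v : HeightOneSpectrum (𝓞 K)) :
    χ.valueAtUniformizer v ≠ 0 := by
  rw [vAU_apply']
  exact Units.ne_zero _

/-- `1(ϖ_v) = 1`. [folklore] -/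
private theorem vAU_one' (v : HeightOneSpectrum (𝓞 K)) :
    (1 : HeckeCharacter K).valueAtUniformizer v = 1 := by
  rw [vAU_apply', GaloisRepresentations.HeckeCharacter.one_apply, Units.val_one]

/-- A unitary character has unitary values at uniformizers. [folklore] -/
private theorem norm_vAU_of_isUnitary {χ : HeckeCharacter K} (hχ : χ.IsUnitary)
    (v : HeightOneSpectrum (𝓞 K)) : ‖χ.valueAtUniformizer v‖ = 1 := by
  rw [vAU_apply']
  exact hχ _

/-- **A Hecke character as a cuspidal datum on `GL(1)`** with Satake parameter `{θ(ϖ_w)}` at almost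
every place: the line `ℂ · (θ ∘ det)` over `⊥` (`exists_automorphicRepData_detTwist_glOne`; on
`GL(1)` every automorphic form is a cusp form, the parabolic condition being empty), with the
Satake parameters of `AutomorphicRepData.hasSatakeParamAt_detTwist_glOne` off a level of `θ`
(`HeckeCharacter.exists_level_glOne`). Borel–Jacquet 1979, 4.6 (automorphic representations of
`GL(1)` = idèle class characters). [cite: BorelJacquetCorvallis1979, §4.6] -/
theorem exists_cuspidal_glOne_hasSatakeParamAt_valueAtUniformizer'
    (h1 : isCompact_glFiniteIntegralLevel 1 K) (θ : HeckeCharacter K) :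
    ∃ τ : CuspidalAutomorphicRepData 1 K h1,
      ∀ᶠ w : HeightOneSpectrum (𝓞 K) in cofinite,
        τ.1.HasSatakeParamAt w {θ.valueAtUniformizer w} := by
  obtain ⟨τ, hW, hW'⟩ := exists_automorphicRepData_detTwist_glOne h1 θ
  have hcusp : τ.W ≤ cuspFormsGL 1 K h1 := by
    rw [hW, Submodule.span_le]
    rintro _ rfl
    exact IsCuspFormGL.mem_cuspFormsGL
      ⟨isAutomorphicForm_detTwist_glOne h1 θ, fun k hk hk1 => absurd hk1 (by omega)⟩
  refine ⟨⟨τ, hcusp⟩, ?_⟩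
  obtain ⟨𝔪, h𝔪, hθ𝔪⟩ :=
    Literature.NumberTheory.GaloisRepresentations.HeckeCharacter.exists_level_glOne θ
  filter_upwards [(Ideal.finite_factors h𝔪).compl_mem_cofinite] with w hw
  have h := AutomorphicRepData.hasSatakeParamAt_detTwist_glOne h1 hW hW' h𝔪 hθ𝔪 w hw
    (Literature.NumberTheory.GaloisRepresentations.HeckeCharacter.valued_uniformizer (K := K) w)
  rwa [← vAU_apply'] at h

end GLOneData

/-! ### The Euler-factor identity and the analytic comparison -/

section Local

/-- **The Euler-factor identity at a good place.** If `l' ∈ {l, l⁻¹}` (as the identity of pairs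
`{l', l'⁻¹} = {l, l⁻¹}` implies) then
`(1 - l' l⁻¹ T)(1 - l' l T) = (1 - T)(1 - l' l' T)` — the unramified factors of
`L(s, λ'λ⁻¹) L(s, λ'λ) = ζ_K(s) L(s, λ'²)`. [folklore] -/
theorem satakePairPolynomial_pair_identity {l l' : ℂ} (hl : l ≠ 0) (h : l' = l ∨ l' = l⁻¹) :
    satakePairPolynomial {l'} {l⁻¹} * satakePairPolynomial {l'} {l} =
      satakePairPolynomial {1} {1} * satakePairPolynomial {l'} {l'} := by
  rcases h with rfl | rfl
  · simp only [satakePairPolynomial, Multiset.product_singleton, Multiset.map_singleton,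
      Multiset.prod_singleton, mul_inv_cancel₀ hl, mul_one]
  · simp only [satakePairPolynomial, Multiset.product_singleton, Multiset.map_singleton,
      Multiset.prod_singleton, inv_mul_cancel₀ hl, mul_one]
    ring

/-- Membership form of the identity of pairs: `{l', l'⁻¹} = {l, l⁻¹}` gives `l' = l ∨ l' = l⁻¹`.
[folklore] -/
theorem eq_or_eq_inv_of_pair_eq {l l' : ℂ}
    (h : ({l', l'⁻¹} : Multiset ℂ) = {l, l⁻¹}) : l' = l ∨ l' = l⁻¹ := by
  have hmem : l' ∈ ({l, l⁻¹} : Multiset ℂ) := by rw [← h]; exact Multiset.mem_cons_self _ _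
  simpa only [Multiset.insert_eq_cons, Multiset.mem_cons, Multiset.mem_singleton] using hmem

/-- **No finite limit equals a pole.** Along the boundary filter `s → 1`, `Re s > 1`: if
`f = g` there, `f → a` (finite) and `(s - 1)ᵏ g → c ≠ 0` with `k ≥ 1`, contradiction
(`(s-1)ᵏ f → 0`). [folklore] -/
theorem false_of_tendsto_of_pole {f g : ℂ → ℂ} {a c : ℂ} {k : ℕ} (hk : 0 < k)
    (hf : Tendsto f (𝓝[{s : ℂ | 1 < s.re}] 1) (𝓝 a))
    (hg : Tendsto (fun s => (s - 1) ^ k * g s) (𝓝[{s : ℂ | 1 < s.re}] 1) (𝓝 c)) (hc : c ≠ 0)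
    (heq : ∀ᶠ s in 𝓝[{s : ℂ | 1 < s.re}] 1, f s = g s) : False := by
  have h0 : Tendsto (fun s : ℂ => (s - 1) ^ k) (𝓝[{s : ℂ | 1 < s.re}] 1) (𝓝 0) := by
    have := (tendsto_sub_one_nhdsWithin_one_lt_re).pow k
    rwa [zero_pow hk.ne'] at this
  have hA : Tendsto (fun s => (s - 1) ^ k * f s) (𝓝[{s : ℂ | 1 < s.re}] 1) (𝓝 (0 * a)) :=
    h0.mul hf
  have hB : Tendsto (fun s => (s - 1) ^ k * f s) (𝓝[{s : ℂ | 1 < s.re}] 1) (𝓝 c) :=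
    hg.congr' (heq.mono fun s hs => by simp only [hs])
  have := tendsto_nhds_unique hA hB
  rw [zero_mul] at this
  exact hc this.symm

end Local

/-! ### The rigidity statement -/

section Main

variable {K : Type} [Field K] [NumberField K]

/-- `{1 · x} = {y⁻¹}⁻¹`-type bookkeeping: the `X`-condition of Jacquet–Shalika (2.2)/(2.3) at
`s₀ = 1` for two rank-one families `{x_w}`, `{y_w}` reads `x_w = y_w⁻¹`. [folklore] -/
private theorem X_condition_singleton_iff (q : ℕ) (x y : ℂ) :
    ({x} : Multiset ℂ).map (((q : ℂ) ^ (1 - (1 : ℂ))) * ·) = ({y} : Multiset ℂ).map (·⁻¹) ↔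
      x = y⁻¹ := by
  rw [sub_self, Complex.cpow_zero, Multiset.map_singleton, Multiset.map_singleton, one_mul,
    Multiset.singleton_inj]

/-- **Rigidity of the pair `{λ, λ⁻¹}`** (Jacquet–Shalika 1981 II, Thm. 4.4 in rank `1 + 1`; the
step "`{μ/μ^θ, μ^θ/μ} = {μ'/μ'^θ, μ'^θ/μ'}`, so replacing `μ'` by `μ'^θ` if necessary `μ/μ'` is
`θ`-invariant" of the dihedral case of Ramakrishnan 2000, Thm. 4.1.2). Granting Jacquet–Shalika
(2.1)–(2.3) for Borel–Jacquet data: if `λ, λ'` are unitary idele class characters of `K` with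
`{λ'(ϖ_w), λ'(ϖ_w)⁻¹} = {λ(ϖ_w), λ(ϖ_w)⁻¹}` for almost all `w`, then `λ' = λ` or `λ' = λ⁻¹`.
Proof in the module docstring. [cite: JacquetShalikaAJM1981II, Prop. 3.6 and Thm. 4.4]
[cite: Ramakrishnan2000, §4.1, proof of Thm. 4.1.2] -/
theorem HeckeCharacter.eq_or_eq_inv_of_eventually_pair_eq
    (hJ1 : JacquetShalika1981_multipliable_partialPairL_repData)
    (hJ2 : JacquetShalika1981_partialPairL_boundary_repData)
    (hJ3 : JacquetShalika1981_partialPairL_pole_repData)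
    (lam lam' : HeckeCharacter K) (hu : lam.IsUnitary) (hu' : lam'.IsUnitary)
    (h : ∀ᶠ w : HeightOneSpectrum (𝓞 K) in cofinite,
      ({lam'.valueAtUniformizer w, (lam'.valueAtUniformizer w)⁻¹} : Multiset ℂ) =
        {lam.valueAtUniformizer w, (lam.valueAtUniformizer w)⁻¹}) :
    lam' = lam ∨ lam' = lam⁻¹ := by
  by_contra hne
  push Not at hne
  have h1 : ¬ ∀ᶠ w : HeightOneSpectrum (𝓞 K) in cofinite,
      lam'.valueAtUniformizer w = lam.valueAtUniformizer w := fun H =>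
    hne.1 (GaloisRepresentations.HeckeCharacter.ext_of_eventually_valueAtUniformizer_eq H)
  have h2 : ¬ ∀ᶠ w : HeightOneSpectrum (𝓞 K) in cofinite,
      lam'.valueAtUniformizer w = (lam.valueAtUniformizer w)⁻¹ := fun H =>
    hne.2 (GaloisRepresentations.HeckeCharacter.ext_of_eventually_valueAtUniformizer_eq
      (H.mono fun w hw => by rw [hw, vAU_inv']))
  have h1K := isCompact_glFiniteIntegralLevel_holds 1 K
  -- the characters as cuspidal data on `GL(1)`
  obtain ⟨τ', hτ'⟩ := exists_cuspidal_glOne_hasSatakeParamAt_valueAtUniformizer' h1K lam'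
  obtain ⟨τ, hτ⟩ := exists_cuspidal_glOne_hasSatakeParamAt_valueAtUniformizer' h1K lam
  obtain ⟨τi, hτi⟩ := exists_cuspidal_glOne_hasSatakeParamAt_valueAtUniformizer' h1K lam⁻¹
  obtain ⟨τ₁, hτ₁⟩ :=
    exists_cuspidal_glOne_hasSatakeParamAt_valueAtUniformizer' h1K (1 : HeckeCharacter K)
  -- the Satake families
  set A' : SatakeFamily K := fun w => {lam'.valueAtUniformizer w} with hA'
  set A : SatakeFamily K := fun w => {lam.valueAtUniformizer w} with hA
  set Ai : SatakeFamily K := fun w => {(lam.valueAtUniformizer w)⁻¹} with hAi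
  set O : SatakeFamily K := fun _ => ({1} : Multiset ℂ) with hO
  -- the exceptional sets of Jacquet–Shalika (2.1)–(2.3) for the five pairs
  obtain ⟨S₁, hS₁, H1⟩ := hJ2 1 1 K h1K h1K one_pos one_pos τ' τi
  obtain ⟨S₂, hS₂, H2⟩ := hJ2 1 1 K h1K h1K one_pos one_pos τ' τ
  obtain ⟨S₃, hS₃, H3⟩ := hJ3 1 K h1K one_pos τ₁ τ₁
  obtain ⟨S₄, hS₄, H4⟩ := hJ2 1 1 K h1K h1K one_pos one_pos τ' τ'
  obtain ⟨S₅, hS₅, H5⟩ := hJ3 1 K h1K one_pos τ' τ'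
  obtain ⟨T₁, hT₁, M1⟩ := hJ1 1 1 K h1K h1K one_pos one_pos τ' τi
  obtain ⟨T₂, hT₂, M2⟩ := hJ1 1 1 K h1K h1K one_pos one_pos τ' τ
  obtain ⟨T₃, hT₃, M3⟩ := hJ1 1 1 K h1K h1K one_pos one_pos τ₁ τ₁
  obtain ⟨T₄, hT₄, M4⟩ := hJ1 1 1 K h1K h1K one_pos one_pos τ' τ'
  -- the good places
  have hgood : ∀ᶠ w : HeightOneSpectrum (𝓞 K) in cofinite,
      τ'.1.HasSatakeParamAt w (A' w) ∧ τ.1.HasSatakeParamAt w (A w) ∧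
        τi.1.HasSatakeParamAt w (Ai w) ∧ τ₁.1.HasSatakeParamAt w (O w) ∧
        (({lam'.valueAtUniformizer w, (lam'.valueAtUniformizer w)⁻¹} : Multiset ℂ) =
          {lam.valueAtUniformizer w, (lam.valueAtUniformizer w)⁻¹}) := by
    filter_upwards [hτ', hτ, hτi, hτ₁, h] with w e1 e2 e3 e4 e5
    refine ⟨e1, e2, ?_, ?_, e5⟩
    · simpa only [hAi, vAU_inv'] using e3
    · simpa only [hO, vAU_one'] using e4
  rw [Filter.eventually_cofinite] at hgood
  set B : Set (HeightOneSpectrum (𝓞 K)) :=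
    {w | ¬ (τ'.1.HasSatakeParamAt w (A' w) ∧ τ.1.HasSatakeParamAt w (A w) ∧
        τi.1.HasSatakeParamAt w (Ai w) ∧ τ₁.1.HasSatakeParamAt w (O w) ∧
        (({lam'.valueAtUniformizer w, (lam'.valueAtUniformizer w)⁻¹} : Multiset ℂ) =
          {lam.valueAtUniformizer w, (lam.valueAtUniformizer w)⁻¹}))} with hBdef
  set S : Set (HeightOneSpectrum (𝓞 K)) :=
    B ∪ S₁ ∪ S₂ ∪ S₃ ∪ S₄ ∪ S₅ ∪ T₁ ∪ T₂ ∪ T₃ ∪ T₄ with hSdef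
  have hS : S.Finite :=
    ((((((((hgood.union hS₁).union hS₂).union hS₃).union hS₄).union hS₅).union hT₁).union
      hT₂).union hT₃).union hT₄
  have hBS : B ⊆ S := fun w hw => by simp only [hSdef, Set.mem_union]; tauto
  have hS₁S : S₁ ⊆ S := fun w hw => by simp only [hSdef, Set.mem_union]; tauto
  have hS₂S : S₂ ⊆ S := fun w hw => by simp only [hSdef, Set.mem_union]; tauto
  have hS₃S : S₃ ⊆ S := fun w hw => by simp only [hSdef, Set.mem_union]; tauto
  have hS₄S : S₄ ⊆ S := fun w hw => by simp only [hSdef, Set.mem_union]; tauto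
  have hS₅S : S₅ ⊆ S := fun w hw => by simp only [hSdef, Set.mem_union]; tauto
  have hT₁S : T₁ ⊆ S := fun w hw => by simp only [hSdef, Set.mem_union]; tauto
  have hT₂S : T₂ ⊆ S := fun w hw => by simp only [hSdef, Set.mem_union]; tauto
  have hT₃S : T₃ ⊆ S := fun w hw => by simp only [hSdef, Set.mem_union]; tauto
  have hT₄S : T₄ ⊆ S := fun w hw => by simp only [hSdef, Set.mem_union]; tauto
  have hgoodS : ∀ w ∉ S, τ'.1.HasSatakeParamAt w (A' w) ∧ τ.1.HasSatakeParamAt w (A w) ∧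
      τi.1.HasSatakeParamAt w (Ai w) ∧ τ₁.1.HasSatakeParamAt w (O w) ∧
      (({lam'.valueAtUniformizer w, (lam'.valueAtUniformizer w)⁻¹} : Multiset ℂ) =
        {lam.valueAtUniformizer w, (lam.valueAtUniformizer w)⁻¹}) := fun w hw => by
    by_contra hc
    exact hw (hBS hc)
  have hA'S : ∀ w ∉ S, τ'.1.HasSatakeParamAt w (A' w) := fun w hw => (hgoodS w hw).1
  have hAS : ∀ w ∉ S, τ.1.HasSatakeParamAt w (A w) := fun w hw => (hgoodS w hw).2.1
  have hAiS : ∀ w ∉ S, τi.1.HasSatakeParamAt w (Ai w) := fun w hw => (hgoodS w hw).2.2.1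
  have hOS : ∀ w ∉ S, τ₁.1.HasSatakeParamAt w (O w) := fun w hw => (hgoodS w hw).2.2.2.1
  have hpair : ∀ w ∉ S, lam'.valueAtUniformizer w = lam.valueAtUniformizer w ∨
      lam'.valueAtUniformizer w = (lam.valueAtUniformizer w)⁻¹ := fun w hw =>
    eq_or_eq_inv_of_pair_eq (hgoodS w hw).2.2.2.2
  -- unitarity of the families
  have huA' : ∀ w ∉ S, ‖(A' w).prod‖ = 1 := fun w _ => by
    simp only [hA', Multiset.prod_singleton, norm_vAU_of_isUnitary hu']
  have huA : ∀ w ∉ S, ‖(A w).prod‖ = 1 := fun w _ => by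
    simp only [hA, Multiset.prod_singleton, norm_vAU_of_isUnitary hu]
  have huAi : ∀ w ∉ S, ‖(Ai w).prod‖ = 1 := fun w _ => by
    simp only [hAi, Multiset.prod_singleton, norm_inv, norm_vAU_of_isUnitary hu, inv_one]
  have huO : ∀ w ∉ S, ‖(O w).prod‖ = 1 := fun w _ => by
    simp only [hO, Multiset.prod_singleton, norm_one]
  -- (2.2) for `(λ', λ⁻¹)` and `(λ', λ)` at `s₀ = 1`: both points lie off `X`
  have hre : (1 : ℂ).re = 1 := Complex.one_re
  obtain ⟨a, ha, Ha⟩ := H1 hS hS₁S hA'S hAiS huA' huAi hre (by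
    rintro ⟨-, H⟩
    refine h1 (H.mono fun w hw => ?_)
    rw [X_condition_singleton_iff] at hw
    rw [hw, inv_inv])
  obtain ⟨b, hb, Hb⟩ := H2 hS hS₂S hA'S hAS huA' huA hre (by
    rintro ⟨-, H⟩
    exact h2 (H.mono fun w hw => (X_condition_singleton_iff _ _ _).mp hw))
  -- (2.3) for `(1, 1)`: `ζ_K^S` has a simple pole at `s = 1`
  obtain ⟨c, hc, Hc⟩ := H3 hS hS₃S hOS hOS huO huO hre
    (Filter.Eventually.of_forall fun w => by
      rw [X_condition_singleton_iff, inv_one])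
  -- (2.1): the four Euler products converge on `re s > 1`
  have heq : ∀ s : ℂ, 1 < s.re →
      partialPairL S A' Ai s * partialPairL S A' A s =
        partialPairL S O O s * partialPairL S A' A' s := by
    intro s hs
    simp only [partialPairL]
    rw [← (M1 hS hT₁S hA'S hAiS huA' huAi hs).tprod_mul (M2 hS hT₂S hA'S hAS huA' huA hs),
      ← (M3 hS hT₃S hOS hOS huO huO hs).tprod_mul (M4 hS hT₄S hA'S hA'S huA' huA' hs)]
    refine tprod_congr fun v => ?_
    have key := congrArg (Polynomial.eval ((v.1.residueCard : ℂ) ^ (-s)))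
      (satakePairPolynomial_pair_identity (vAU_ne_zero' lam v.1) (hpair v.1 v.2))
    rw [Polynomial.eval_mul, Polynomial.eval_mul] at key
    rw [← mul_inv, ← mul_inv, key]
  have heq' : ∀ᶠ s in 𝓝[{s : ℂ | 1 < s.re}] 1,
      partialPairL S A' Ai s * partialPairL S A' A s =
        partialPairL S O O s * partialPairL S A' A' s :=
    eventually_mem_nhdsWithin.mono fun s hs => heq s hs
  -- `L^S(s, λ'²)`: a pole or a non-zero limit at `s = 1`
  by_cases hsq : ∀ᶠ w : HeightOneSpectrum (𝓞 K) in cofinite,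
      lam'.valueAtUniformizer w = (lam'.valueAtUniformizer w)⁻¹
  · obtain ⟨d, hd, Hd⟩ := H5 hS hS₅S hA'S hA'S huA' huA' hre
      (hsq.mono fun w hw => (X_condition_singleton_iff _ _ _).mpr hw)
    refine false_of_tendsto_of_pole (k := 2) two_pos (Ha.mul Hb) ?_ (mul_ne_zero hc hd) heq'
    exact (Hc.mul Hd).congr fun s => by ring
  · obtain ⟨d, hd, Hd⟩ := H4 hS hS₄S hA'S hA'S huA' huA' hre (fun H => hsq
      (H.2.mono fun w hw => (X_condition_singleton_iff _ _ _).mp hw))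
    refine false_of_tendsto_of_pole (k := 1) one_pos (Ha.mul Hb) ?_ (mul_ne_zero hc hd) heq'
    exact (Hc.mul Hd).congr fun s => by ring

end Main

end Literature.NumberTheory.Automorphic

end
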